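import Summits.QuantumFields.YangMills.Theorems.LuscherReductionDressedRitzPolyakovLiftPScalingLevelsWindow
import HarnessLib

/-!
# ONE AT COUPLING `B`: the `e^{−τ}` cluster-gap feed and the global window floor (F9 layer D1b″ for S-PSCAL″ of crux `DressedRitz`,
# stmt-QuantumFields-20205, line «polyakovlift» r7; seat ym-20205-polyakovlift-w1a g1; helper `--supports`)

Two scalar feeds of `PScal.dressed_clauses_of_concentration'` (tree `…PScalingCoreGap`) read off `PScal.levels_window` (tree `…PScalingLevelsWindow`):
* `gapτ_of_window`: from the window gap `cgap·ν·x ≤ λ_lo − λ_hi`, the spread `λ_lo ≤ λ_j + 3C·ν·x²`, `λ_j ≤ 2ν`, and the smallness `12·C·x ≤ cgap`,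
  `0 ≤ τ ≤ cgap·x/8`: `λ_hi ≤ e^{−τ}·λ_j` — the hypothesis `hgapτ` (pure real arithmetic, stated abstractly);
* `floor_antitone`: the window floors `ν e^{−E_j x − C x²}` decrease with the level, so the TOP floor (`j = K`) serves as the single `lamlow` of the core theorem.

HONEST FRAMING: elementary real inequalities (conditional femto rung R2b1); nothing here bears on infinite volume, the continuum limit or the Clay gap.
References: M. Lüscher, NPB 219 (1983) 233 [cite: Luscher1983, §2].
-/

set_option autoImplicit false

noncomputable section

open Real
open Literature.Analysis.OperatorTheory.YMMatrixModel

namespace Summit.QuantumFields.YangMills.Theorems.FemtoTransferGap.PScal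

open Summit.QuantumFields.YangMills.Theorems.FemtoTransferGap

/-- ★ **The `e^{−τ}` gap feed.**  If `cgap·ν·x ≤ lamlo − lamhi`, `lamlo ≤ lamj + 3C·ν·x²`, `0 ≤ lamj ≤ 2ν`, `12·C·x ≤ cgap` and `0 ≤ τ ≤ cgap·x/8`, then
`lamhi ≤ e^{−τ}·lamj`. [folklore] -/
theorem gapτ_of_window {ν x C cgap τ lamlo lamhi lamj : ℝ} (hν : 0 ≤ ν) (hx : 0 ≤ x)
    (hgap : cgap * ν * x ≤ lamlo - lamhi) (hspread : lamlo ≤ lamj + 3 * C * ν * x ^ 2) (hj0 : 0 ≤ lamj) (hj2 : lamj ≤ 2 * ν)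
    (hsmall : 12 * C * x ≤ cgap) (hτ0 : 0 ≤ τ) (hτ : τ ≤ cgap * x / 8) :
    lamhi ≤ Real.exp (-τ) * lamj := by
  have h1 : 1 - τ ≤ Real.exp (-τ) := by linarith [Real.add_one_le_exp (-τ)]
  have h2 : (1 - τ) * lamj ≤ Real.exp (-τ) * lamj := mul_le_mul_of_nonneg_right h1 hj0
  have h3 : τ * lamj ≤ cgap * x / 8 * (2 * ν) := mul_le_mul hτ hj2 hj0 (by nlinarith)
  have h4 : 3 * C * ν * x ^ 2 ≤ cgap * ν * x / 4 := by
    have : 3 * C * x ≤ cgap / 4 := by linarith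
    nlinarith [mul_nonneg hν hx]
  nlinarith

/-- ★ **Window floors are antitone in the level**: `E_j ≤ E_{j′} ⇒ ν e^{−E_{j′} x − Cx²} ≤ ν e^{−E_j x − Cx²}`; in particular the floor of the top index `K`
lies below every window floor `j ≤ K`. [folklore] -/
theorem floor_antitone {ν x C : ℝ} (hν : 0 ≤ ν) (hx : 0 ≤ x) {j j' : ℕ} (hjj : j ≤ j') :
    ν * Real.exp (-(idxLevel j' * x) - C * x ^ 2) ≤ ν * Real.exp (-(idxLevel j * x) - C * x ^ 2) := by
  refine mul_le_mul_of_nonneg_left (Real.exp_le_exp.2 ?_) hν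
  have := mul_le_mul_of_nonneg_right (idxLevel_mono hjj) hx
  linarith

/-- Every window member lies above the top floor: for `j ≤ K` and `m ∈ [winLo j, winHi j)`, `ν e^{−E_K x − Cx²} ≤ λ_m` whenever
`ν e^{−E_j x − Cx²} ≤ λ_m` (the `hlow` feed with a single `lamlow`). [folklore] -/
theorem topFloor_le_of_floor_le {ν x C lam : ℝ} (hν : 0 ≤ ν) (hx : 0 ≤ x) {j K : ℕ} (hjK : j ≤ K)
    (h : ν * Real.exp (-(idxLevel j * x) - C * x ^ 2) ≤ lam) :
    ν * Real.exp (-(idxLevel K * x) - C * x ^ 2) ≤ lam :=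
  (floor_antitone hν hx hjK).trans h

/-- The top floor carries the dressed-ratio constant: `λ_0^{2n} ≤ Γ_j·floor_j^{2n}` and `floor_K ≤ floor_j`… in the direction needed, `Γ_K` dominates:
`λ_0^{2n} ≤ exp(2n((E_K − E_0)x + 2Cx²))·floor_K^{2n}` is (w2) at `j = K` verbatim; this lemma records that the exponent is monotone in the level so one `Γ`
serves all windows. [folklore] -/
theorem ratioExp_mono {x C : ℝ} (hx : 0 ≤ x) (n : ℕ) {j K : ℕ} (hjK : j ≤ K) :
    Real.exp (2 * n * ((idxLevel j - idxLevel 0) * x + 2 * C * x ^ 2)) ≤ Real.exp (2 * n * ((idxLevel K - idxLevel 0) * x + 2 * C * x ^ 2)) := by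
  refine Real.exp_le_exp.2 (mul_le_mul_of_nonneg_left ?_ (by positivity))
  have := mul_le_mul_of_nonneg_right (idxLevel_mono hjK) hx
  linarith

end Summit.QuantumFields.YangMills.Theorems.FemtoTransferGap.PScal

end
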